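import Summits.FinalStateConjecture.FinalStateConjecture.Theses.BartnikGapSettling
import Literature.Geometry.Lorentzian.TameGenericityDiagonal
import Summits.FinalStateConjecture.FinalStateConjecture.Theorems.TameCensorshipCollarMargin.Negative.TameCensorshipCollarMarginFalseOfExtremalJunkCollars

/-!
# Line lead verdict package for crux `TameCensorshipCollarMargin` (stmt-FinalStateConjecture-17329)

prover-line-stmt-FinalStateConjecture-17329-0 (line lead, opening), 2026-08-17. Scratch / evidence
file, NOT a tree proposal and NOT a statement item (D-0014: the planner restates). Sorry-free.

* §1 — the picked line `birth` is DEAD at its transfer stub: `stub_unwindowing` (registered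
  signature, verbatim) is refuted by ONE admissible maximal development that has complete `𝓘⁺`,
  the windowed margin C‴₂ and extremal junk collars at every tolerance (`stub_unwindowing_false_of`).
  The junk is the far-field mimicry of `Cruxes/GenericCensorshipCollarMargin/MisstatedByMimicry.md`
  (hypothesis `ExtremalJunkCollars`, p103863 / this crux's Negative module); the good windowed
  development is e.g. the Minkowski MGHD (windowed margin vacuous by the curvature obstruction).
  No reshape survives: ANY stub set whose composition reaches the FILED clause for such a
  development meets `not_collarMarginClause_of_junk` (`filedClause_false_of_junk`).
* §2 — what the statement should say: `TameCensorshipCollarMarginW`, the filed text with the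
  margin conjunct replaced by the WINDOWED ORDER-2 clause C‴₂ (label window `m₀ ≤ M₁ ≤ m₀⁻¹` and
  boost window `max ‖Λ‖ ‖Λ⁻¹‖ ≤ ρ₀` quantified BEFORE `(χ₁, δ₁, K₁)`, order `2`; converged over the
  10809/10808 leads: `RestatementProbeC3.lean`, `VERDICT-c3.md`, `RESTATED_c4.lean` §1), and the
  kernel-checked fact that the two honest stubs of `birth` imply it VERBATIM
  (`tameCensorshipCollarMarginW_of_stubs` = `birth.crux_body_of_stub_sigs` minus its last `mono`).
* §3 — the route still closes after the restatement: `GapExhaustionW` (hypothesis := the same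
  windowed clause, rest verbatim) and `closesW : BondiBartnikRigidity → GapExhaustionW →
  SettledCapture → TameCensorshipCollarMarginW → MGHDExists → FinalStateConjecture`, the route's
  `closes` with the margin handed over whole.
Nothing is asserted about the truth of any restated item.
-/

noncomputable section

-- D-0017: single-problem summit, `Summit.<S>.<S>.…` by design (cf. lakefile `weak.linter.dupNamespace`).
set_option linter.dupNamespace false

open Set Function
open scoped Manifold ContDiff Topology ENNReal

namespace Summit.FinalStateConjecture.FinalStateConjecture.Cruxes.TameCensorshipCollarMargin.LeadVerdict

open Literature.Geometry.Lorentzian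
open Summit.FinalStateConjecture.FinalStateConjecture.Theses.BartnikGapSettling
  (BondiBartnikRigidity SettledCapture MGHDExists TameCensorshipCollarMargin)
open Summit.FinalStateConjecture.FinalStateConjecture.Theorems.GenericCensorshipCollarMargin.Negative
  (ExtremalJunkCollars not_collarMarginClause_of_junk)

/-! ## §1 The line `birth` is dead at `stub_unwindowing` -/

section Death

variable {X : Type} [TopologicalSpace X] [ChartedSpace E3 X]
  [IsManifold (𝓡 3) ((⊤ : ℕ∞) : WithTop ℕ∞) X] [ConnectedSpace X] {D : InitialDataSet (𝓡 3) X}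

/-- **Any composition reaching the filed clause meets the junk.** For a development carrying
extremal-label junk collars at every tolerance `(k₁, δ₁, K₁)`, the FILED (un-windowed) margin
clause is false — whatever stubs produced it. (`not_collarMarginClause_of_junk`, restated for the
record of the dead line.) [folklore] -/
theorem filedClause_false_of_junk (𝒟 : VacuumCauchyDevelopment D)
    (hJ : ∀ (k₁ : ℕ) (δ₁ : ℝ≥0∞) (K₁ : Set 𝒟.carrier), 0 < δ₁ → IsCompact K₁ →
        ∃ (M₁ : ℝ) (mo₁ : lorentzGroup × E4) (B₁ : ModelBackground)
          (Φ₁ : B₁.domain → 𝒟.carrier),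
          0 < M₁ ∧
          B₁ = starBackground mo₁.1 mo₁.2 M₁ M₁
            (fun x => Kerr.radius M₁ (poincareInv mo₁.1 mo₁.2 x)) ∧
          ContMDiffOn 𝓘(ℝ, E4) (𝓡 4) ((⊤ : ℕ∞) : WithTop ℕ∞) Φ₁
            {x | -1 < B₁.time x.1 ∧ B₁.time x.1 < 1 ∧ B₁.radius x.1 < 3 * M₁ + 1} ∧
          Topology.IsOpenEmbedding
            ({x | -1 < B₁.time x.1 ∧ B₁.time x.1 < 1 ∧ B₁.radius x.1 < 3 * M₁ + 1}.restrict Φ₁) ∧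
          𝒟.toSpacetime.truncDeviationCk B₁ Φ₁ k₁ (3 * M₁) 0 ≤ δ₁ ∧
          Disjoint (Φ₁ '' B₁.truncTimeSlab (3 * M₁) 0)
            (𝒟.metric.causalPast 𝒟.timeOrientation K₁)) :
    ¬ (∃ (χ₁ : ℝ) (k₁ : ℕ) (δ₁ : ENNReal) (K₁ : Set 𝒟.carrier), χ₁ < 1 ∧ 0 < δ₁ ∧ IsCompact K₁ ∧ ∀ (M₁ a₁ : ℝ) (mo₁ : lorentzGroup × E4) (B₁ : ModelBackground) (Φ₁ : B₁.domain → 𝒟.carrier), 0 < M₁ → |a₁| ≤ M₁ → B₁ = starBackground mo₁.1 mo₁.2 M₁ a₁ (fun x => Kerr.radius a₁ (poincareInv mo₁.1 mo₁.2 x)) → ContMDiffOn 𝓘(ℝ, E4) (𝓡 4) ((⊤ : ℕ∞) : WithTop ℕ∞) Φ₁ {x | -1 < B₁.time x.1 ∧ B₁.time x.1 < 1 ∧ B₁.radius x.1 < 3 * M₁ + 1} → Topology.IsOpenEmbedding ({x | -1 < B₁.time x.1 ∧ B₁.time x.1 < 1 ∧ B₁.radius x.1 < 3 * M₁ + 1}.restrict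 Φ₁) → 𝒟.toSpacetime.truncDeviationCk B₁ Φ₁ k₁ (3 * M₁) 0 ≤ δ₁ → Disjoint (Φ₁ '' B₁.truncTimeSlab (3 * M₁) 0) (𝒟.metric.causalPast 𝒟.timeOrientation K₁) → |a₁| ≤ χ₁ * M₁) :=
  not_collarMarginClause_of_junk 𝒟 hJ

end Death

/-- **`stub_unwindowing` is false on one good development with junk.** If some admissible datum on
some `X` has a maximal development with complete `𝓘⁺`, the windowed order-`2` margin C‴₂ and
extremal junk collars at every tolerance, then the registered signature of `stub_unwindowing`
(verbatim) is false. Expected instance: the Minkowski MGHD of `trivialData` (C‴₂ vacuous there by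
the curvature obstruction; junk by `ExtremalJunkCollars`); not constructible in the tree today
(needs a development PROVED maximal, and convex integration). [folklore] -/
theorem stub_unwindowing_false_of
    (X : Type) [TopologicalSpace X] [ChartedSpace E3 X]
    [IsManifold (𝓡 3) ((⊤ : ℕ∞) : WithTop ℕ∞) X] [T2Space X] [SecondCountableTopology X]
    [ConnectedSpace X]
    (D : InitialDataSet (𝓡 3) X) (hD : D ∈ admissibleVacuumData X)
    (𝒟 : VacuumCauchyDevelopment D) (hmax : 𝒟.IsMaximal)
    (hCNI : Summit.FinalStateConjecture.HasCompleteNullInfinity 𝒟.toCauchyDevelopment)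
    (hW : (∀ m₀ ρ₀ : ℝ, 0 < m₀ → 0 < ρ₀ → ∃ (χ₁ : ℝ) (δ₁ : ENNReal) (K₁ : Set 𝒟.carrier), χ₁ < 1 ∧ 0 < δ₁ ∧ IsCompact K₁ ∧ ∀ (M₁ a₁ : ℝ) (mo₁ : lorentzGroup × E4) (B₁ : ModelBackground) (Φ₁ : B₁.domain → 𝒟.carrier), m₀ ≤ M₁ → M₁ ≤ m₀⁻¹ → max ‖((mo₁.1 : E4 ≃L[ℝ] E4) : E4 →L[ℝ] E4)‖ ‖((mo₁.1 : E4 ≃L[ℝ] E4).symm : E4 →L[ℝ] E4)‖ ≤ ρ₀ → |a₁| ≤ M₁ → B₁ = starBackground mo₁.1 mo₁.2 M₁ a₁ (fun x => Kerr.radius a₁ (poincareInv mo₁.1 mo₁.2 x)) → ContMDiffOn 𝓘(ℝ, E4) (𝓡 4) ((⊤ : ℕ∞) : WithTop ℕ∞) Φ₁ {x | -1 < B₁.time x.1 ∧ B₁.time x.1 < 1 ∧ B₁.radius x.1 < 3 * M₁ + 1} → Topology.IsOpenEmbedding ({x | -1 < B₁.time x.1 ∧ B₁.time x.1 < 1 ∧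 B₁.radius x.1 < 3 * M₁ + 1}.restrict Φ₁) → 𝒟.toSpacetime.truncDeviationCk B₁ Φ₁ 2 (3 * M₁) 0 ≤ δ₁ → Disjoint (Φ₁ '' B₁.truncTimeSlab (3 * M₁) 0) (𝒟.metric.causalPast 𝒟.timeOrientation K₁) → |a₁| ≤ χ₁ * M₁))
    (hJ : ∀ (k₁ : ℕ) (δ₁ : ℝ≥0∞) (K₁ : Set 𝒟.carrier), 0 < δ₁ → IsCompact K₁ →
        ∃ (M₁ : ℝ) (mo₁ : lorentzGroup × E4) (B₁ : ModelBackground)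
          (Φ₁ : B₁.domain → 𝒟.carrier),
          0 < M₁ ∧
          B₁ = starBackground mo₁.1 mo₁.2 M₁ M₁
            (fun x => Kerr.radius M₁ (poincareInv mo₁.1 mo₁.2 x)) ∧
          ContMDiffOn 𝓘(ℝ, E4) (𝓡 4) ((⊤ : ℕ∞) : WithTop ℕ∞) Φ₁
            {x | -1 < B₁.time x.1 ∧ B₁.time x.1 < 1 ∧ B₁.radius x.1 < 3 * M₁ + 1} ∧
          Topology.IsOpenEmbedding
            ({x | -1 < B₁.time x.1 ∧ B₁.time x.1 < 1 ∧ B₁.radius x.1 < 3 * M₁ + 1}.restrict Φ₁) ∧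
          𝒟.toSpacetime.truncDeviationCk B₁ Φ₁ k₁ (3 * M₁) 0 ≤ δ₁ ∧
          Disjoint (Φ₁ '' B₁.truncTimeSlab (3 * M₁) 0)
            (𝒟.metric.causalPast 𝒟.timeOrientation K₁)) :
    ¬ (∀ (X : Type) [TopologicalSpace X] [ChartedSpace E3 X] [IsManifold (𝓡 3) ((⊤ : ℕ∞) : WithTop ℕ∞) X] [T2Space X] [SecondCountableTopology X] [ConnectedSpace X], ∀ D ∈ admissibleVacuumData X, ∀ 𝒟 : VacuumCauchyDevelopment D, 𝒟.IsMaximal → Summit.FinalStateConjecture.HasCompleteNullInfinity 𝒟.toCauchyDevelopment → (∀ m₀ ρ₀ : ℝ, 0 < m₀ → 0 < ρ₀ → ∃ (χ₁ : ℝ) (δ₁ : ENNReal) (K₁ : Set 𝒟.carrier), χ₁ < 1 ∧ 0 < δ₁ ∧ IsCompact K₁ ∧ ∀ (M₁ a₁ : ℝ) (mo₁ : lorentzGroup × E4) (B₁ : ModelBackground) (Φ₁ : B₁.domain → 𝒟.carrier), m₀ ≤ M₁ → M₁ ≤ m₀⁻¹ → max ‖((mo₁.1 : E4 ≃L[ℝ]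 E4) : E4 →L[ℝ] E4)‖ ‖((mo₁.1 : E4 ≃L[ℝ] E4).symm : E4 →L[ℝ] E4)‖ ≤ ρ₀ → |a₁| ≤ M₁ → B₁ = starBackground mo₁.1 mo₁.2 M₁ a₁ (fun x => Kerr.radius a₁ (poincareInv mo₁.1 mo₁.2 x)) → ContMDiffOn 𝓘(ℝ, E4) (𝓡 4) ((⊤ : ℕ∞) : WithTop ℕ∞) Φ₁ {x | -1 < B₁.time x.1 ∧ B₁.time x.1 < 1 ∧ B₁.radius x.1 < 3 * M₁ + 1} → Topology.IsOpenEmbedding ({x | -1 < B₁.time x.1 ∧ B₁.time x.1 < 1 ∧ B₁.radius x.1 < 3 * M₁ + 1}.restrict Φ₁) → 𝒟.toSpacetime.truncDeviationCk B₁ Φ₁ 2 (3 * M₁) 0 ≤ δ₁ → Disjoint (Φ₁ '' B₁.truncTimeSlab (3 * M₁) 0) (𝒟.metric.causalPast 𝒟.timeOrientation K₁) → |a₁| ≤ χ₁ * M₁) → (∃ (χ₁ : ℝ) (k₁ : ℕ) (δ₁ : ENNReal) (K₁ : Set 𝒟.carrier), χ₁ < 1 ∧ 0 < δ₁ ∧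 IsCompact K₁ ∧ ∀ (M₁ a₁ : ℝ) (mo₁ : lorentzGroup × E4) (B₁ : ModelBackground) (Φ₁ : B₁.domain → 𝒟.carrier), 0 < M₁ → |a₁| ≤ M₁ → B₁ = starBackground mo₁.1 mo₁.2 M₁ a₁ (fun x => Kerr.radius a₁ (poincareInv mo₁.1 mo₁.2 x)) → ContMDiffOn 𝓘(ℝ, E4) (𝓡 4) ((⊤ : ℕ∞) : WithTop ℕ∞) Φ₁ {x | -1 < B₁.time x.1 ∧ B₁.time x.1 < 1 ∧ B₁.radius x.1 < 3 * M₁ + 1} → Topology.IsOpenEmbedding ({x | -1 < B₁.time x.1 ∧ B₁.time x.1 < 1 ∧ B₁.radius x.1 < 3 * M₁ + 1}.restrict Φ₁) → 𝒟.toSpacetime.truncDeviationCk B₁ Φ₁ k₁ (3 * M₁) 0 ≤ δ₁ → Disjoint (Φ₁ '' B₁.truncTimeSlab (3 * M₁) 0) (𝒟.metric.causalPast 𝒟.timeOrientation K₁) → |a₁| ≤ χ₁ * M₁)) := by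
  intro h₃
  exact not_collarMarginClause_of_junk 𝒟 hJ (h₃ X D hD 𝒟 hmax hCNI hW)

/-- Named-hypothesis corollary: under `ExtremalJunkCollars`, ONE admissible maximal development
with complete `𝓘⁺` and the windowed margin (on any `X`) refutes `stub_unwindowing`. [folklore] -/
theorem stub_unwindowing_false_of_ExtremalJunkCollars (hJ : ExtremalJunkCollars)
    (X : Type) [TopologicalSpace X] [ChartedSpace E3 X]
    [IsManifold (𝓡 3) ((⊤ : ℕ∞) : WithTop ℕ∞) X] [T2Space X] [SecondCountableTopology X]
    [ConnectedSpace X]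
    (D : InitialDataSet (𝓡 3) X) (hD : D ∈ admissibleVacuumData X)
    (𝒟 : VacuumCauchyDevelopment D) (hmax : 𝒟.IsMaximal)
    (hCNI : Summit.FinalStateConjecture.HasCompleteNullInfinity 𝒟.toCauchyDevelopment)
    (hW : (∀ m₀ ρ₀ : ℝ, 0 < m₀ → 0 < ρ₀ → ∃ (χ₁ : ℝ) (δ₁ : ENNReal) (K₁ : Set 𝒟.carrier), χ₁ < 1 ∧ 0 < δ₁ ∧ IsCompact K₁ ∧ ∀ (M₁ a₁ : ℝ) (mo₁ : lorentzGroup × E4) (B₁ : ModelBackground) (Φ₁ : B₁.domain → 𝒟.carrier), m₀ ≤ M₁ → M₁ ≤ m₀⁻¹ → max ‖((mo₁.1 : E4 ≃L[ℝ] E4) : E4 →L[ℝ] E4)‖ ‖((mo₁.1 : E4 ≃L[ℝ] E4).symm : E4 →L[ℝ] E4)‖ ≤ ρ₀ → |a₁| ≤ M₁ → B₁ = starBackground mo₁.1 mo₁.2 M₁ a₁ (fun x => Kerr.radius a₁ (poincareInv mo₁.1 mo₁.2 x)) → ContMDiffOn 𝓘(ℝ, E4) (𝓡 4) ((⊤ :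 ℕ∞) : WithTop ℕ∞) Φ₁ {x | -1 < B₁.time x.1 ∧ B₁.time x.1 < 1 ∧ B₁.radius x.1 < 3 * M₁ + 1} → Topology.IsOpenEmbedding ({x | -1 < B₁.time x.1 ∧ B₁.time x.1 < 1 ∧ B₁.radius x.1 < 3 * M₁ + 1}.restrict Φ₁) → 𝒟.toSpacetime.truncDeviationCk B₁ Φ₁ 2 (3 * M₁) 0 ≤ δ₁ → Disjoint (Φ₁ '' B₁.truncTimeSlab (3 * M₁) 0) (𝒟.metric.causalPast 𝒟.timeOrientation K₁) → |a₁| ≤ χ₁ * M₁)) :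
    ¬ (∀ (X : Type) [TopologicalSpace X] [ChartedSpace E3 X] [IsManifold (𝓡 3) ((⊤ : ℕ∞) : WithTop ℕ∞) X] [T2Space X] [SecondCountableTopology X] [ConnectedSpace X], ∀ D ∈ admissibleVacuumData X, ∀ 𝒟 : VacuumCauchyDevelopment D, 𝒟.IsMaximal → Summit.FinalStateConjecture.HasCompleteNullInfinity 𝒟.toCauchyDevelopment → (∀ m₀ ρ₀ : ℝ, 0 < m₀ → 0 < ρ₀ → ∃ (χ₁ : ℝ) (δ₁ : ENNReal) (K₁ : Set 𝒟.carrier), χ₁ < 1 ∧ 0 < δ₁ ∧ IsCompact K₁ ∧ ∀ (M₁ a₁ : ℝ) (mo₁ : lorentzGroup × E4) (B₁ : ModelBackground) (Φ₁ : B₁.domain → 𝒟.carrier), m₀ ≤ M₁ → M₁ ≤ m₀⁻¹ → max ‖((mo₁.1 : E4 ≃L[ℝ] E4) : E4 →L[ℝ] E4)‖ ‖((mo₁.1 : E4 ≃L[ℝ] E4).symm : E4 →L[ℝ] E4)‖ ≤ ρ₀ → |a₁| ≤ M₁ → B₁ = starBackground mo₁.1 mo₁.2 M₁ a₁ (fun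 x => Kerr.radius a₁ (poincareInv mo₁.1 mo₁.2 x)) → ContMDiffOn 𝓘(ℝ, E4) (𝓡 4) ((⊤ : ℕ∞) : WithTop ℕ∞) Φ₁ {x | -1 < B₁.time x.1 ∧ B₁.time x.1 < 1 ∧ B₁.radius x.1 < 3 * M₁ + 1} → Topology.IsOpenEmbedding ({x | -1 < B₁.time x.1 ∧ B₁.time x.1 < 1 ∧ B₁.radius x.1 < 3 * M₁ + 1}.restrict Φ₁) → 𝒟.toSpacetime.truncDeviationCk B₁ Φ₁ 2 (3 * M₁) 0 ≤ δ₁ → Disjoint (Φ₁ '' B₁.truncTimeSlab (3 * M₁) 0) (𝒟.metric.causalPast 𝒟.timeOrientation K₁) → |a₁| ≤ χ₁ * M₁) → (∃ (χ₁ : ℝ) (k₁ : ℕ) (δ₁ : ENNReal) (K₁ : Set 𝒟.carrier), χ₁ < 1 ∧ 0 < δ₁ ∧ IsCompact K₁ ∧ ∀ (M₁ a₁ : ℝ) (mo₁ : lorentzGroup × E4) (B₁ : ModelBackground) (Φ₁ : B₁.domain → 𝒟.carrier), 0 < M₁ → |a₁| ≤ M₁ → B₁ = starBackground mo₁.1 mo₁.2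 M₁ a₁ (fun x => Kerr.radius a₁ (poincareInv mo₁.1 mo₁.2 x)) → ContMDiffOn 𝓘(ℝ, E4) (𝓡 4) ((⊤ : ℕ∞) : WithTop ℕ∞) Φ₁ {x | -1 < B₁.time x.1 ∧ B₁.time x.1 < 1 ∧ B₁.radius x.1 < 3 * M₁ + 1} → Topology.IsOpenEmbedding ({x | -1 < B₁.time x.1 ∧ B₁.time x.1 < 1 ∧ B₁.radius x.1 < 3 * M₁ + 1}.restrict Φ₁) → 𝒟.toSpacetime.truncDeviationCk B₁ Φ₁ k₁ (3 * M₁) 0 ≤ δ₁ → Disjoint (Φ₁ '' B₁.truncTimeSlab (3 * M₁) 0) (𝒟.metric.causalPast 𝒟.timeOrientation K₁) → |a₁| ≤ χ₁ * M₁)) :=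
  stub_unwindowing_false_of X D hD 𝒟 hmax hCNI hW (hJ X D hD 𝒟 hmax)

/-! ## §2 What the statement should say, and the two honest stubs imply it -/

/-- **Restated crux C‴₂ (tame): `TameCensorshipCollarMargin` with the margin WINDOWED and at
order `2`.** For every connected Hausdorff second-countable `3`-manifold `X`, tame-generically in
the admissible class, every MGHD has complete `𝓘⁺` AND, for every label window `0 < m₀` and boost
bound `0 < ρ₀`, some `χ₁ < 1`, `δ₁ > 0`, compact `K₁` such that every thick collar chart with
`m₀ ≤ M₁ ≤ m₀⁻¹`, `max ‖Λ‖ ‖Λ⁻¹‖ ≤ ρ₀`, `|a₁| ≤ M₁`, smooth on and an open embedding of the collar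
layer, `δ₁`-close in `C²` to boosted Kerr on the thick slab and beyond `J⁻(K₁)`, has
`|a₁| ≤ χ₁ M₁`. The filed text verbatim except for the second conjunct (10809/10808 leads'
converged repair; `Cruxes/GenericCensorshipCollarMargin/VERDICT-c3.md` items 1–3). -/
def TameCensorshipCollarMarginW : Prop :=
  ∀ (X : Type) [TopologicalSpace X] [ChartedSpace E3 X] [IsManifold (𝓡 3) ((⊤ : ℕ∞) : WithTop ℕ∞) X] [T2Space X] [SecondCountableTopology X] [ConnectedSpace X], InitialDataSet.IsTameChristodoulouGeneric (admissibleVacuumData X) (fun D => ∀ 𝒟 : VacuumCauchyDevelopment D, 𝒟.IsMaximal → Summit.FinalStateConjecture.HasCompleteNullInfinity 𝒟.toCauchyDevelopment ∧ (∀ m₀ ρ₀ : ℝ, 0 < m₀ → 0 < ρ₀ → ∃ (χ₁ : ℝ) (δ₁ : ENNReal) (K₁ : Set 𝒟.carrier), χ₁ < 1 ∧ 0 < δ₁ ∧ IsCompact K₁ ∧ ∀ (M₁ a₁ : ℝ) (mo₁ : lorentzGroup × E4) (B₁ : ModelBackground) (Φ₁ : B₁.domain → 𝒟.carrier), m₀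 ≤ M₁ → M₁ ≤ m₀⁻¹ → max ‖((mo₁.1 : E4 ≃L[ℝ] E4) : E4 →L[ℝ] E4)‖ ‖((mo₁.1 : E4 ≃L[ℝ] E4).symm : E4 →L[ℝ] E4)‖ ≤ ρ₀ → |a₁| ≤ M₁ → B₁ = starBackground mo₁.1 mo₁.2 M₁ a₁ (fun x => Kerr.radius a₁ (poincareInv mo₁.1 mo₁.2 x)) → ContMDiffOn 𝓘(ℝ, E4) (𝓡 4) ((⊤ : ℕ∞) : WithTop ℕ∞) Φ₁ {x | -1 < B₁.time x.1 ∧ B₁.time x.1 < 1 ∧ B₁.radius x.1 < 3 * M₁ + 1} → Topology.IsOpenEmbedding ({x | -1 < B₁.time x.1 ∧ B₁.time x.1 < 1 ∧ B₁.radius x.1 < 3 * M₁ + 1}.restrict Φ₁) → 𝒟.toSpacetime.truncDeviationCk B₁ Φ₁ 2 (3 * M₁) 0 ≤ δ₁ → Disjoint (Φ₁ '' B₁.truncTimeSlab (3 * M₁) 0) (𝒟.metric.causalPast 𝒟.timeOrientation K₁) → |a₁| ≤ χ₁ * M₁)) 1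

/-- **The two honest stubs of `birth` imply the restated crux, verbatim** (the skeleton's
`crux_body_of_stub_sigs` without its final un-windowing `mono`): composition of tame genericities
along curves, `InitialDataSet.isTameChristodoulouGeneric_of_relative` with `Q :=` censorship and
`P :=` censorship `∧` C‴₂; constant curves are tame on the sole strongly flat end of an admissible
datum (`exists_isSoleEnd_of_mem_admissibleVacuumData`). [folklore] -/
theorem tameCensorshipCollarMarginW_of_stubs
    (h₁ : ∀ (X : Type) [TopologicalSpace X] [ChartedSpace E3 X] [IsManifold (𝓡 3) ((⊤ : ℕ∞) : WithTop ℕ∞) X] [T2Space X] [SecondCountableTopology X] [ConnectedSpace X], InitialDataSet.IsTameChristodoulouGeneric (admissibleVacuumData X) (fun D => ∀ 𝒟 : VacuumCauchyDevelopment D, 𝒟.IsMaximal → Summit.FinalStateConjecture.HasCompleteNullInfinity 𝒟.toCauchyDevelopment) 1)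
    (h₂ : ∀ (X : Type) [TopologicalSpace X] [ChartedSpace E3 X] [IsManifold (𝓡 3) ((⊤ : ℕ∞) : WithTop ℕ∞) X] [T2Space X] [SecondCountableTopology X] [ConnectedSpace X], ∀ (e : AFEnd X) (F : EuclideanSpace ℝ (Fin 1) → InitialDataSet (𝓡 3) X), InitialDataSet.IsTameDataFamily e 1 F → ((InitialDataSet.IsImmersedAtZero 1 F ∧ Function.Injective F) ∨ ∀ c, F c = F 0) → (∀ c, F c ∈ admissibleVacuumData X) → (∀ c ≠ 0, ∀ 𝒟 : VacuumCauchyDevelopment (F c), 𝒟.IsMaximal → Summit.FinalStateConjecture.HasCompleteNullInfinity 𝒟.toCauchyDevelopment) → ∃ F' : EuclideanSpace ℝ (Fin 1) → InitialDataSet (𝓡 3) X, InitialDataSet.IsTameDataFamily e 1 F' ∧ F' 0 = F 0 ∧ Function.Injective F' ∧ InitialDataSet.IsImmersedAtZero 1 F' ∧ (∀ c, F' c ∈ admissibleVacuumData X) ∧ ∀ c ≠ 0, ∀ 𝒟 : VacuumCauchyDevelopment (F' c), 𝒟.IsMaximal → Summit.FinalStateConjecture.HasCompleteNullInfinity 𝒟.toCauchyDevelopment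 ∧ (∀ m₀ ρ₀ : ℝ, 0 < m₀ → 0 < ρ₀ → ∃ (χ₁ : ℝ) (δ₁ : ENNReal) (K₁ : Set 𝒟.carrier), χ₁ < 1 ∧ 0 < δ₁ ∧ IsCompact K₁ ∧ ∀ (M₁ a₁ : ℝ) (mo₁ : lorentzGroup × E4) (B₁ : ModelBackground) (Φ₁ : B₁.domain → 𝒟.carrier), m₀ ≤ M₁ → M₁ ≤ m₀⁻¹ → max ‖((mo₁.1 : E4 ≃L[ℝ] E4) : E4 →L[ℝ] E4)‖ ‖((mo₁.1 : E4 ≃L[ℝ] E4).symm : E4 →L[ℝ] E4)‖ ≤ ρ₀ → |a₁| ≤ M₁ → B₁ = starBackground mo₁.1 mo₁.2 M₁ a₁ (fun x => Kerr.radius a₁ (poincareInv mo₁.1 mo₁.2 x)) → ContMDiffOn 𝓘(ℝ, E4) (𝓡 4) ((⊤ : ℕ∞) : WithTop ℕ∞) Φ₁ {x | -1 < B₁.time x.1 ∧ B₁.time x.1 < 1 ∧ B₁.radius x.1 < 3 * M₁ + 1} → Topology.IsOpenEmbedding ({x | -1 < B₁.time x.1 ∧ B₁.time x.1 < 1 ∧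 B₁.radius x.1 < 3 * M₁ + 1}.restrict Φ₁) → 𝒟.toSpacetime.truncDeviationCk B₁ Φ₁ 2 (3 * M₁) 0 ≤ δ₁ → Disjoint (Φ₁ '' B₁.truncTimeSlab (3 * M₁) 0) (𝒟.metric.causalPast 𝒟.timeOrientation K₁) → |a₁| ≤ χ₁ * M₁)) :
    TameCensorshipCollarMarginW := by
  intro X _ _ _ _ _ _
  exact InitialDataSet.isTameChristodoulouGeneric_of_relative
    (Q := fun D => ∀ 𝒟 : VacuumCauchyDevelopment D, 𝒟.IsMaximal →
      Summit.FinalStateConjecture.HasCompleteNullInfinity 𝒟.toCauchyDevelopment)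
    (fun d hd => exists_isSoleEnd_of_mem_admissibleVacuumData hd) (h₁ X)
    (fun e F hF hdich h𝓓 hQ => h₂ X e F hF hdich h𝓓 hQ)

/-- The filed crux and the filed `stub_unwindowing` together give back the filed statement from
the restated one only through the dead stub; conversely the restated crux is NOT implied by the
filed one (order `k₁` existential vs. pinned `2`) — they are incomparable, so the restatement is a
genuine replacement, not a weakening of record. (Documentation lemma: the restated property
follows pointwise from "censorship ∧ C‴₂", trivially.) [folklore] -/
theorem tameCensorshipCollarMarginW.property_iff (X : Type) [TopologicalSpace X] [ChartedSpace E3 X]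
    [IsManifold (𝓡 3) ((⊤ : ℕ∞) : WithTop ℕ∞) X] [T2Space X] [SecondCountableTopology X]
    [ConnectedSpace X] (D : InitialDataSet (𝓡 3) X) :
    (∀ 𝒟 : VacuumCauchyDevelopment D, 𝒟.IsMaximal → Summit.FinalStateConjecture.HasCompleteNullInfinity 𝒟.toCauchyDevelopment ∧ (∀ m₀ ρ₀ : ℝ, 0 < m₀ → 0 < ρ₀ → ∃ (χ₁ : ℝ) (δ₁ : ENNReal) (K₁ : Set 𝒟.carrier), χ₁ < 1 ∧ 0 < δ₁ ∧ IsCompact K₁ ∧ ∀ (M₁ a₁ : ℝ) (mo₁ : lorentzGroup × E4) (B₁ : ModelBackground) (Φ₁ : B₁.domain → 𝒟.carrier), m₀ ≤ M₁ → M₁ ≤ m₀⁻¹ → max ‖((mo₁.1 : E4 ≃L[ℝ] E4) : E4 →L[ℝ] E4)‖ ‖((mo₁.1 : E4 ≃L[ℝ] E4).symm : E4 →L[ℝ] E4)‖ ≤ ρ₀ → |a₁| ≤ M₁ → B₁ = starBackground mo₁.1 mo₁.2 M₁ a₁ (fun x => Kerr.radius a₁ (poincareInv mo₁.1 mo₁.2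 x)) → ContMDiffOn 𝓘(ℝ, E4) (𝓡 4) ((⊤ : ℕ∞) : WithTop ℕ∞) Φ₁ {x | -1 < B₁.time x.1 ∧ B₁.time x.1 < 1 ∧ B₁.radius x.1 < 3 * M₁ + 1} → Topology.IsOpenEmbedding ({x | -1 < B₁.time x.1 ∧ B₁.time x.1 < 1 ∧ B₁.radius x.1 < 3 * M₁ + 1}.restrict Φ₁) → 𝒟.toSpacetime.truncDeviationCk B₁ Φ₁ 2 (3 * M₁) 0 ≤ δ₁ → Disjoint (Φ₁ '' B₁.truncTimeSlab (3 * M₁) 0) (𝒟.metric.causalPast 𝒟.timeOrientation K₁) → |a₁| ≤ χ₁ * M₁)) ↔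
    ((∀ 𝒟 : VacuumCauchyDevelopment D, 𝒟.IsMaximal → Summit.FinalStateConjecture.HasCompleteNullInfinity 𝒟.toCauchyDevelopment) ∧
      ∀ 𝒟 : VacuumCauchyDevelopment D, 𝒟.IsMaximal → (∀ m₀ ρ₀ : ℝ, 0 < m₀ → 0 < ρ₀ → ∃ (χ₁ : ℝ) (δ₁ : ENNReal) (K₁ : Set 𝒟.carrier), χ₁ < 1 ∧ 0 < δ₁ ∧ IsCompact K₁ ∧ ∀ (M₁ a₁ : ℝ) (mo₁ : lorentzGroup × E4) (B₁ : ModelBackground) (Φ₁ : B₁.domain → 𝒟.carrier), m₀ ≤ M₁ → M₁ ≤ m₀⁻¹ → max ‖((mo₁.1 : E4 ≃L[ℝ] E4) : E4 →L[ℝ] E4)‖ ‖((mo₁.1 : E4 ≃L[ℝ] E4).symm : E4 →L[ℝ] E4)‖ ≤ ρ₀ → |a₁| ≤ M₁ → B₁ = starBackground mo₁.1 mo₁.2 M₁ a₁ (fun x => Kerr.radius a₁ (poincareInv mo₁.1 mo₁.2 x)) → ContMDiffOn 𝓘(ℝ, E4) (𝓡 4) ((⊤ : ℕ∞) : WithTop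 ℕ∞) Φ₁ {x | -1 < B₁.time x.1 ∧ B₁.time x.1 < 1 ∧ B₁.radius x.1 < 3 * M₁ + 1} → Topology.IsOpenEmbedding ({x | -1 < B₁.time x.1 ∧ B₁.time x.1 < 1 ∧ B₁.radius x.1 < 3 * M₁ + 1}.restrict Φ₁) → 𝒟.toSpacetime.truncDeviationCk B₁ Φ₁ 2 (3 * M₁) 0 ≤ δ₁ → Disjoint (Φ₁ '' B₁.truncTimeSlab (3 * M₁) 0) (𝒟.metric.causalPast 𝒟.timeOrientation K₁) → |a₁| ≤ χ₁ * M₁)) :=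
  ⟨fun h => ⟨fun 𝒟 h𝒟 => (h 𝒟 h𝒟).1, fun 𝒟 h𝒟 => (h 𝒟 h𝒟).2⟩,
    fun h 𝒟 h𝒟 => ⟨h.1 𝒟 h𝒟, h.2 𝒟 h𝒟⟩⟩

/-! ## §3 The route still closes after the restatement -/

/-- **`GapExhaustion` restated in lockstep**: its collar-margin HYPOTHESIS replaced by the same
windowed order-`2` clause C‴₂ (everything else verbatim the filed item 10808). -/
def GapExhaustionW : Prop :=
  ∀ (X : Type) [TopologicalSpace X] [ChartedSpace E3 X] [IsManifold (𝓡 3) ((⊤ : ℕ∞) : WithTop ℕ∞) X] [T2Space X] [SecondCountableTopology X] [ConnectedSpace X], ∀ D ∈ admissibleVacuumData X, ∀ 𝒟 : VacuumCauchyDevelopment D, 𝒟.IsMaximal → Summit.FinalStateConjecture.HasCompleteNullInfinity 𝒟.toCauchyDevelopment → (∀ m₀ ρ₀ : ℝ, 0 < m₀ → 0 < ρ₀ → ∃ (χ₁ : ℝ) (δ₁ : ENNReal) (K₁ : Set 𝒟.carrier), χ₁ < 1 ∧ 0 < δ₁ ∧ IsCompact K₁ ∧ ∀ (M₁ a₁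 : ℝ) (mo₁ : lorentzGroup × E4) (B₁ : ModelBackground) (Φ₁ : B₁.domain → 𝒟.carrier), m₀ ≤ M₁ → M₁ ≤ m₀⁻¹ → max ‖((mo₁.1 : E4 ≃L[ℝ] E4) : E4 →L[ℝ] E4)‖ ‖((mo₁.1 : E4 ≃L[ℝ] E4).symm : E4 →L[ℝ] E4)‖ ≤ ρ₀ → |a₁| ≤ M₁ → B₁ = starBackground mo₁.1 mo₁.2 M₁ a₁ (fun x => Kerr.radius a₁ (poincareInv mo₁.1 mo₁.2 x)) → ContMDiffOn 𝓘(ℝ, E4) (𝓡 4) ((⊤ : ℕ∞) : WithTop ℕ∞) Φ₁ {x | -1 < B₁.time x.1 ∧ B₁.time x.1 < 1 ∧ B₁.radius x.1 < 3 * M₁ + 1} → Topology.IsOpenEmbedding ({x | -1 < B₁.time x.1 ∧ B₁.time x.1 < 1 ∧ B₁.radius x.1 < 3 * M₁ + 1}.restrict Φ₁) → 𝒟.toSpacetime.truncDeviationCk B₁ Φ₁ 2 (3 * M₁) 0 ≤ δ₁ → Disjoint (Φ₁ '' B₁.truncTimeSlab (3 * M₁) 0) (𝒟.metric.causalPast 𝒟.timeOrientation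 K₁) → |a₁| ≤ χ₁ * M₁) → ∃ (N₀ : ℕ) (m₀ χ : ℝ), 0 < m₀ ∧ χ < 1 ∧ ∀ k : ℕ, ∃ Λ : ENNReal, Λ < ⊤ ∧ ∀ (δ : ENNReal) (γ : ℝ), 0 < δ → 0 < γ → ∀ K : Set 𝒟.carrier, IsCompact K → ∃ (N : ℕ) (M a : Fin N → ℝ) (S : Set 𝒟.carrier) (p : 𝒟.carrier) (mo' : Fin N → lorentzGroup × E4) (B' : Fin N → ModelBackground) (Φ : ∀ i, (B' i).domain → 𝒟.carrier), N ≤ N₀ ∧ (∀ i, m₀ ≤ M i ∧ M i ≤ m₀⁻¹ ∧ |a i| ≤ χ * M i) ∧ 𝒟.toCauchyDevelopment.IsNearKerrLeaf k Λ N M a S ∧ p ∈ S ∧ Disjoint (𝒟.metric.causalFuture 𝒟.timeOrientation S) (𝒟.metric.causalPast 𝒟.timeOrientation K) ∧ (∀ i, B' i = starBackground (mo' i).1 (mo' i).2 (M i) (a i) (fun x => Kerr.radius (a i) (poincareInv (mo' i).1 (mo' i).2 x))) ∧ (∀ i, ContMDiffOn 𝓘(ℝ, E4) (𝓡 4) ((⊤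 : ℕ∞) : WithTop ℕ∞) (Φ i) {x | -1 < (B' i).time x.1 ∧ (B' i).time x.1 < 1 ∧ (B' i).radius x.1 < 3 * M i + 1} ∧ Topology.IsOpenEmbedding ({x | -1 < (B' i).time x.1 ∧ (B' i).time x.1 < 1 ∧ (B' i).radius x.1 < 3 * M i + 1}.restrict (Φ i))) ∧ (∀ i, 𝒟.toSpacetime.truncDeviationCk (B' i) (Φ i) k (3 * M i) 0 ≤ δ) ∧ (∀ i, Φ i '' (B' i).truncTimeSlab (3 * M i) 0 ⊆ S) ∧ Pairwise (Function.onFun Disjoint fun i => Φ i '' (B' i).truncTimeSlab (3 * M i) 0) ∧ (∃ m : ℝ, 𝒟.toCauchyDevelopment.HasCutBondiMass ({p} ∪ ⋃ i, Φ i '' (B' i).truncTimeSlab (3 * M i) 0) m) ∧ (∀ (X' : Type) [TopologicalSpace X'] [ChartedSpace E3 X'] [IsManifold (𝓡 3) ((⊤ : ℕ∞) : WithTop ℕ∞) X'] [T2Space X'] [SecondCountableTopology X'] [ConnectedSpace X'], ∀ D' ∈ admissibleVacuumData X', ∀ (𝒟' : VacuumCauchyDevelopment D') (U : Set 𝒟.carrier)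 (φ : 𝒟.carrier → 𝒟'.carrier) (m' : ℝ), 𝒟'.IsMaximal → IsOpen U → ({p} ∪ ⋃ i, Φ i '' (B' i).truncTimeSlab (3 * M i) 0) ⊆ U → ContMDiffOn (𝓡 4) (𝓡 4) ((⊤ : ℕ∞) : WithTop ℕ∞) φ U → Topology.IsOpenEmbedding (U.restrict φ) → (∀ q ∈ U, pullbackBilin (I := 𝓡 4) (I' := 𝓡 4) φ 𝒟'.metric.val q = 𝒟.metric.val q) → (∀ q ∈ U, 𝒟'.timeOrientation.IsFutureDirected (mfderiv (𝓡 4) (𝓡 4) φ q (𝒟.timeOrientation.vectorField q))) → 𝒟'.toCauchyDevelopment.HasCutBondiMass (φ '' ({p} ∪ ⋃ i, Φ i '' (B' i).truncTimeSlab (3 * M i) 0)) m' → ∀ η : ℝ, 0 < η → ∃ m : ℝ, 𝒟.toCauchyDevelopment.HasCutBondiMass ({p} ∪ ⋃ i, Φ i '' (B' i).truncTimeSlab (3 * M i) 0) m ∧ m ≤ m' + γ + η)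

/-- **Deciding theorem after the restatement** — the route's `closes` verbatim, with the margin
handed from `TameCensorshipCollarMarginW` to `GapExhaustionW` whole. Axioms: propext,
Classical.choice, Quot.sound. [folklore] -/
theorem closesW : BondiBartnikRigidity → GapExhaustionW → SettledCapture → TameCensorshipCollarMarginW →
    MGHDExists → FinalStateConjecture := by
  intro h₁ h₂ h₃ h₄ h₅ X _ _ _ _ _ _
  have mono : ∀ {P Q : Literature.Geometry.Lorentzian.InitialDataSet (𝓡 3) X → Prop},
      Literature.Geometry.Lorentzian.InitialDataSet.IsTameChristodoulouGeneric
          (Literature.Geometry.Lorentzian.admissibleVacuumData X) P 1 →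
        (∀ D ∈ Literature.Geometry.Lorentzian.admissibleVacuumData X, P D → Q D) →
          Literature.Geometry.Lorentzian.InitialDataSet.IsTameChristodoulouGeneric
            (Literature.Geometry.Lorentzian.admissibleVacuumData X) Q 1 := by
    intro P Q h hPQ d hd
    obtain ⟨e, F, hT, hI, h0, hinj, hDF, hE⟩ := h d ⟨hd.1, fun hP => hd.2 (hPQ d hd.1 hP)⟩
    exact ⟨e, F, hT, hI, h0, hinj, hDF,
      fun c hc hc' => hE c hc ⟨hc'.1, fun hP => hc'.2 (hPQ _ hc'.1 hP)⟩⟩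
  refine mono (h₄ X) ?_
  intro D hD hP
  refine ⟨h₅ X D hD, fun 𝒟 hmax => ?_⟩
  obtain ⟨hCNI, hCM⟩ := hP 𝒟 hmax
  refine ⟨hCNI, h₃ X D hD 𝒟 hmax hCNI ?_⟩
  obtain ⟨N₀, m₀, χ, hm₀, hχ, H2⟩ := h₂ X D hD 𝒟 hmax hCNI hCM
  refine ⟨N₀, m₀, χ, 0, ⊤, hm₀, hχ, ENNReal.zero_lt_top, fun k ε hε K hK => ?_⟩
  obtain ⟨k', H1⟩ := h₁ χ m₀ N₀ k ε hχ hm₀ hε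
  obtain ⟨Λ, hΛ, H2'⟩ := H2 k'
  obtain ⟨δ, γ, hδ, hγ, H1'⟩ := H1 Λ hΛ
  obtain ⟨N, M, a, S, p, mo', B', Φ, hN, hwin, hleaf, hp, hlate, c1, c2, c3, c4, c5, c6, c7⟩ :=
    H2' δ γ hδ hγ K hK
  obtain ⟨S', hleaf', hS'⟩ :=
    H1' X D hD 𝒟 N M a S p mo' B' Φ hmax hN hwin hleaf hp c1 c2 c3 c4 c5 c6 c7
  refine ⟨N, M, a, S', hN, fun i => ⟨(hwin i).1, (hwin i).2.1⟩, Disjoint.mono_left hS' hlate, ?_,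
    fun _ _ i => (hwin i).2.2⟩
  exact hleaf'

end Summit.FinalStateConjecture.FinalStateConjecture.Cruxes.TameCensorshipCollarMargin.LeadVerdict

end
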